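import Summits.BirchSwinnertonDyer.BirchSwinnertonDyer.Theorems.KatoDescentTamePotSupersingularJetchevIrreducibleReadingThm52NamedPrintOnlyPB2
import Summits.BirchSwinnertonDyer.BirchSwinnertonDyer.Theorems.KatoDescentPotSupersingularWildJetchevBoundAtPHeegnerE0ImageFree
import HarnessLib

/-!
# Crux `JetchevIrreducibleReadingByName` (item 20165, shared K8-t′ 19982 / K9 19197): THE NODE `Sig.H63IRowObjectsAddv` (carrier `q ∥ N`,
# `q ≠ p`) WITH THE RECEPTACLE SCHEMA `hGZ` FED BY NAME from the image-free Literature fact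
# `Gross1991_heegnerPoint_sub_ratTorsion_mem_E0_imageFree` (p544901) through `HeegnerE0ImageFree.forall_hGZ_of_Gross1991_imageFree`
# (p546756) — `node ⟸ {h47P2, hPT} + [GZ86 III (3.1)] by name`; seat `bsd-potss-k9-c4` g10; route-free; `--supports 20165`, helper

HONEST FRAMING. Theorems only; CONDITIONAL on every displayed hypothesis; nothing booked, no item closed, 20165 / 19941 / their stubs
and BSD stay open. WHAT THIS IS — the 20165 twin of `…WildJetchevBoundAtPGross1991` (19941, carrier at `p`): k8t-c4 g11's
`JetchevIrreducibleH63P2.h63IRowObjectsAddv_of_poitouTate_of_GZ31_of_prop47P2` (p544748: the node ⟸ {`h47P2`, `hPT`, `hGZ`}, itself k9-c4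
g9's p541990 re-keyed `h44I ↦ h47P2`) carried ONE closed cite-only schema, `hGZ` ([GZ86 III (3.1)] in the receptacle form, bsd-jet
read-1's guarded `HGZKolyvagin` body closed over all Heegner frames with `E[p]` irreducible). On the surjective rows cell `bsd-jet` feeds
it by name from the Gross-scoped fact (`JET.forall_hGZ_of_Gross1991`, ty g10); on the irreducible NON-surjective rows that fact does not
apply (Gross §2 standing hypotheses) and k9-c4 g9 typed the sentence image-free (p544901). THIS FILE:
* `h63IRowObjectsAddv_of_poitouTate_of_GZ31g_of_prop47P2` — p544748's statement and proof VERBATIM except that the `hGZ` binder carries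
  the printed guards `d_K ≠ −3, −4` (Gross 1991 §1 p. 235; binder `hGZg` = the conclusion of
  `HeegnerE0ImageFree.forall_hGZ_of_Gross1991_imageFree`) and the one call `hGZ W K hK hH …` becomes `hGZg W K hK hD3 hD4 hH …` (the
  frame has `hD3`, `hD4` in scope; the unguarded closure over `d_K ∈ {−3, −4}` is no longer displayed);
* `h63IRowObjectsAddv_of_poitouTate_of_Gross1991_of_prop47P2 (h47P2) (hPT) (hF1)` — `hGZg` FED by the image-free fact: **node ⟸
  {h47P2, hPT} + the named Literature fact `Gross1991_heegnerPoint_sub_ratTorsion_mem_E0_imageFree`**.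
SEQUEL (part 2, `…JetchevIrreducibleReadingThm52Gross1991NamedFacts`, split for the 400-line rule): the `h44I`-keyed form (registered
S5 text; k9-c4 g9's p541990 with `hGZ` fed by name) and **the node from THREE NAMED LITERATURE FACTS ONLY** {Gross 3.7 (2)
`GrossLMS1991.prop37_2_frobeniusCongruence` via k8t-c4 g11's `h47P2_of_prop37_2` (p541604), Poitou–Tate
`poitouTate_selmerStructure_duality_conj`, [GZ86 III (3.1)] `Gross1991_heegnerPoint_sub_ratTorsion_mem_E0_imageFree`}.
ACCOUNTING after the two files (crux 20165): `JetchevIrreducibleReadingByName` ⟸ S1 (`stub_structureIrred`, MN19 Thm. 0.7, held by name)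
∧ S2′ (`stub_prop52IrredP`) ∧ S3′ (`stub_coreVertexExistenceIrredP`) ∧ {Gross 3.7 (2), Poitou–Tate, GZ86 III (3.1): NAMED Literature
facts} ∧ `PublishedInputsHeegner` (via the registered `_of` of skeleton v6 with S5/S6 so fed); proposed joint cut for the planner: S5 ↦
`stub_prop47IrredP2` (k8t-c4 v7c; closed modulo Gross 3.7 (2)), S6 ↦ `stub_thm52NamedFacts := (∀ K, poitouTate_selmerStructure_duality_conj K)
∧ Gross1991_heegnerPoint_sub_ratTorsion_mem_E0_imageFree` (two Literature `def`s by name, held like S1), node `:= …_of_Gross1991_of_prop47P2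
h5 h6.1 h6.2`. BSD is not proved by any of this.

References: [cite: Jetchev2008, Thm. 1.4, Thm. 5.2 (p. 821), Prop. 4.7, Prop. 4.9] [cite: McCallumLMS1991, §4 Prop. 4.4]
[cite: GrossLMS1991, §1 p. 235, §3 (3.1), Prop. 3.7 (2), §6 proof of Prop. 6.2 (1) p. 245] [cite: GrossZagier1986Heegner, III (3.1) Proposition, p. 256]
[cite: Howard2004HeegnerKolyvagin, Prop. 2.1.9 (ii), Lemma 2.7.3] [cite: MilneADT2006, Ch. I, Thm. 4.10(b)]
[cite: SilvermanAEC2009, VII.2 Prop. 2.1, App. C §15 Table 15.1].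

presearch (D-0021): `lean search 'of_Gross1991|imageFree'` → bsd-jet's surjective-row supplies and the predecessor files only; no
irreducible-row `_of_Gross1991` node in the tree. Pure composition of tree theorems; corpus queries not needed (sources = p544901's).
-/


set_option autoImplicit false
-- the Theorems directory repeats the summit name (sibling precedent `KatoDescentPotSupersingularAssembly.lean`)
set_option linter.dupNamespace false

noncomputable section

open scoped Classical Pointwise

open WeierstrassCurve IsDedekindDomain NumberField Field Literature.NumberTheory.EllipticCurves
  Literature.NumberTheory.EllipticCurves.ModularForms Literature.NumberTheory.EllipticCurves.Jetchev2008
  Literature.NumberTheory.GaloisRepresentations Literature.NumberTheory.GaloisCohomology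
  Literature.NumberTheory.GaloisRepresentations.DiscreteGaloisModule
  Summit.BirchSwinnertonDyer.Rank1Residual.X11b Summit.BirchSwinnertonDyer.Rank1Residual.X11b.Three
  Summit.BirchSwinnertonDyer.Rank1Residual.JET
  Summit.BirchSwinnertonDyer.Rank1Residual.JET.SelmerVocabulary Literature.NumberTheory.Automorphic
  Summit.BirchSwinnertonDyer.BirchSwinnertonDyer.Theorems
  Summit.BirchSwinnertonDyer.BirchSwinnertonDyer.Theorems.JetchevIrreducibleH63P2

namespace Summit.BirchSwinnertonDyer.BirchSwinnertonDyer.Theorems.JetchevIrreducibleReadingThm52Gross1991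

/-- **`Sig.H63IRowObjectsAddv` ⟸ {`h47P2`, `hPT`, `hGZg`}** — k8t-c4 g11's
`JetchevIrreducibleH63P2.h63IRowObjectsAddv_of_poitouTate_of_GZ31_of_prop47P2` (p544748) VERBATIM except that the receptacle schema
carries the printed guards `d_K ≠ −3, −4` (binder `hGZg`, the conclusion of `HeegnerE0ImageFree.forall_hGZ_of_Gross1991_imageFree`) and
is called at the frame's own `hD3`, `hD4`. `hloc`, `h𝒯σ`, `h𝒯sd`, `htr` discharged by the bsd-jet closers as there; `Φ_q` cyclic by
`JET.kodairaNeron_isAddCyclic_forall`. Conclusion text verbatim. CONDITIONAL; nothing asserted.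
[cite: Jetchev2008, Thm. 5.2 (p. 821), Thm. 1.4, Prop. 4.7, Prop. 4.9] [cite: GrossLMS1991, §1 p. 235, §6 p. 245]
[cite: Howard2004HeegnerKolyvagin, Prop. 2.1.9 (ii), Lemma 2.7.3] -/
theorem h63IRowObjectsAddv_of_poitouTate_of_GZ31g_of_prop47P2
    -- [J] Prop. 4.7 / [McC] Prop. 4.4 (B) in the irreducible reading, PRIMED, `ℓ ≠ 2` (k8t-c4 g11's `h47P2`, verbatim)
    (h47P2 : ∀ (W : WeierstrassCurve ℚ) [W.IsElliptic] [W.IsGloballyMinimal] [NeZero (W.conductorNorm ℤ)],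
        ¬ W.HasCM →
        ∀ (K : Type) [Field K] [NumberField K], IsImaginaryQuadratic K →
        NumberField.discr K ≠ -3 → NumberField.discr K ≠ -4 →
        SatisfiesHeegnerHypothesis (W.conductorNorm ℤ) K →
        ∀ (p : ℕ) [Fact p.Prime], p ≠ 2 → W.HasIrreducibleModPGaloisRep p → (p : ℤ) ∣ W.conductorNorm ℤ →
        ∀ (Dt : ModularParametrizationData W (W.conductorNorm ℤ)) (β : ℤ) (ι : K →+* ℂ)
          (M : ℕ), 1 ≤ M →
        ∀ (m l : ℕ), Squarefree (m * l) → l.Prime → l ≠ 2 → ¬ l ∣ m →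
          (∀ l' ∈ (m * l).primeFactors, Zhang2014.IsKolyvaginPrime (W.conductorNorm ℤ) W K p l' ∧
            M ≤ Zhang2014.kolyvaginIndex W p l') →
        ∀ (d : KolyvaginHeegnerData Dt β ι m) (d' : KolyvaginHeegnerData Dt β ι (m * l)),
          (∀ l' ∈ m.primeFactors, ∀ (x : ringClassField K ι m) (x' : ringClassField K ι (m * l)),
            (x : ℂ) = x' → ((d'.σ l' x' : ringClassField K ι (m * l)) : ℂ) = (d.σ l' x : ℂ)) →
          (∀ s ∈ d.S, ∃ s' ∈ d'.S, ∀ (x : ringClassField K ι m) (x' : ringClassField K ι (m * l)),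
            (x : ℂ) = x' → ((s' x' : ringClassField K ι (m * l)) : ℂ) = (s x : ℂ)) →
          (∀ s' ∈ d'.S, ∃ s ∈ d.S, ∀ (x : ringClassField K ι m) (x' : ringClassField K ι (m * l)),
            (x : ℂ) = x' → ((s' x' : ringClassField K ι (m * l)) : ℂ) = (s x : ℂ)) →
          (∀ (x : ringClassField K ι m) (x' : ringClassField K ι (m * l)),
            (x : ℂ) = x' → d'.emb x' = d.emb x) →
        ∀ (v : HeightOneSpectrum (𝓞 K)), (l : 𝓞 K) ∈ v.asIdeal →
        ∀ (j : ℕ),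
          (((p ^ j : ℕ) : ℤ) • d'.kolyvaginClass (Fact.out : p.Prime) M ∈
              (W.baseChange K).torsionLocalKer (v.adicCompletion K) ((p ^ M : ℕ) : ℤ) ↔
            ((p ^ j : ℕ) : ℤ) • d.kolyvaginClass (Fact.out : p.Prime) M ∈
              (W.baseChange K).torsionLocalKer (v.adicCompletion K) ((p ^ M : ℕ) : ℤ)))
    -- NAMED FACT: Poitou–Tate duality for the tree's Selmer structures (∀ K)
    (hPT : ∀ (K : Type) [Field K] [NumberField K], poitouTate_selmerStructure_duality_conj K)
    -- [GZ86 III (3.1)] in the receptacle form, closed WITH ALL the printed guards incl. `d_K ≠ −3, −4` (Gross 1991 §1 p. 235)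
    (hGZg : ∀ (W : WeierstrassCurve ℚ) [W.IsElliptic] [W.IsGloballyMinimal] [NeZero (W.conductorNorm ℤ)]
      (K : Type) [Field K] [NumberField K], IsImaginaryQuadratic K →
      NumberField.discr K ≠ -3 → NumberField.discr K ≠ -4 →
      SatisfiesHeegnerHypothesis (W.conductorNorm ℤ) K →
      ∀ (p : ℕ) [Fact p.Prime], p ≠ 2 → W.HasIrreducibleModPGaloisRep p →
      ∀ (Dt : ModularParametrizationData W (W.conductorNorm ℤ)) (β : ℤ) (ι : K →+* ℂ)
      [∀ j : ℕ, NumberField (ringClassField K ι j)],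
      ∃ n' : ℤ, IsCoprime (p : ℤ) n' ∧ ∀ (m : ℕ), Squarefree m →
        (∀ q ∈ m.primeFactors, Zhang2014.IsKolyvaginPrime (W.conductorNorm ℤ) W K p q) →
        ∀ (dm : KolyvaginHeegnerData Dt β ι m)
        (γ : ringClassField K ι m ≃ₐ[ℚ] ringClassField K ι m), γ ∈ ringClassGal ι m →
        ∀ v : HeightOneSpectrum (𝓞 K), ¬ (W.baseChange K).HasGoodReductionAt v →
          n' • pointsMap (W.baseChange K) (v.adicCompletion K)
              (dm.toGeomPoints (pointGalHom W (ringClassField K ι m) γ dm.y)) ∈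
            E0Receptacle (W.baseChange K) v ∧
          ∀ (ℓ : ℕ), ℓ ∈ m.primeFactors → ∀ (dm' : KolyvaginHeegnerData Dt β ι (m / ℓ))
            (hle : ringClassField K ι (m / ℓ) ≤ ringClassField K ι m),
            n' • pointsMap (W.baseChange K) (v.adicCompletion K)
                (dm.toGeomPoints (pointGalHom W (ringClassField K ι m) γ
                  (WeierstrassCurve.Affine.Point.map (W' := W)
                    ((RingClassField.inclusion ι hle).restrictScalars ℚ) dm'.y))) ∈
              E0Receptacle (W.baseChange K) v) :
    -- CONCLUSION: the body of `Sig.H63IRowObjectsAddv` (registered skeleton v6 of crux 20165), verbatim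
    ∀ (W : WeierstrassCurve ℚ) [W.IsElliptic] [W.IsGloballyMinimal] [NeZero (W.conductorNorm ℤ)],
    ¬ W.HasCM → ∀ (K : Type) [Field K] [NumberField K], IsImaginaryQuadratic K →
    NumberField.discr K ≠ -3 → NumberField.discr K ≠ -4 →
    SatisfiesHeegnerHypothesis (W.conductorNorm ℤ) K →
    ∀ (τ : K ≃ₐ[ℚ] K), τ ≠ 1 →
    ∀ (p : ℕ) [Fact p.Prime], p ≠ 2 → Rank1Residual.Addv W p → 0 ≤ padicValRat p W.j →
    W.HasIrreducibleModPGaloisRep p →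
    ¬ p ∣ (W.baseChange ℚ_[p]).localTamagawaNumber ℤ_[p] →
    (∀ (q' : ℕ) [Fact q'.Prime], q' ∣ W.conductorNorm ℤ →
      p ∣ (W.baseChange ℚ_[q']).localTamagawaNumber ℤ_[q'] → ¬ q' ^ 2 ∣ W.conductorNorm ℤ) →
    ∀ (Dt : ModularParametrizationData W (W.conductorNorm ℤ)) (β : ℤ) (ι : K →+* ℂ)
      [∀ k : ℕ, NumberField (ringClassField K ι k)]
      (d₁ : KolyvaginHeegnerData Dt β ι 1), ¬ IsOfFinAddOrder d₁.derivedPoint →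
    ∀ (q : ℕ) [Fact q.Prime], q ∣ W.conductorNorm ℤ → ¬ q ^ 2 ∣ W.conductorNorm ℤ → q ≠ p →
    ∀ (mdiv m : {c : ℕ // Squarefree c ∧ ∀ ℓ ∈ c.primeFactors,
        Zhang2014.IsKolyvaginPrime (W.conductorNorm ℤ) W K p ℓ} → ℕ∞),
    (∀ c (u : ℕ), (u : ℕ∞) ≤ mdiv c ↔ ∀ d : KolyvaginHeegnerData Dt β ι c.1,
      ∃ Q : (W.baseChange (ringClassField K ι c.1)).toAffine.Point,
        ((p ^ u : ℕ) : ℤ) • Q = d.derivedPoint) →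
    (∀ c, m c = if mdiv c < Zhang2014.levelIndex W p c.1 then mdiv c else ⊤) →
    ∀ mInf : ℕ, (∀ c, (mInf : ℕ∞) ≤ m c) →
      (∀ m' : ℕ, ∃ c, (m' : ℕ∞) ≤ Zhang2014.levelIndex W p c.1 ∧ m c = mInf) →
    ∀ (k : ℕ) c, 1 ≤ k → Jetchev2008.IsGlobalCoreVertex W K ι τ p k c.1 → m c = mInf →
      (k : ℕ∞) + mInf ≤ Zhang2014.levelIndex W p c.1 →
      padicValNat p ((W.baseChange ℚ_[q]).localTamagawaNumber ℤ_[q]) < k → mInf < k →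
      padicValNat p ((W.baseChange ℚ_[q]).localTamagawaNumber ℤ_[q]) ≤ mInf := by
  intro W _ _ _ hcm K _ _ hK hD3 hD4 hH τ hτ p _ hp2 hadd _ hirr _ _ Dt β ι _ d₁ _ q _ hq _ _
    mdiv m hmdiv hm mInf _ _ k c hk hcore hmc hkM htk hik
  have hp : p.Prime := Fact.out
  have hD : NumberField.discr K < -4 := KolyvaginAssembly.discr_lt_neg_four hK ⟨hD3, hD4⟩
  have hpN : p ∣ W.conductorNorm ℤ := (W.dvd_conductorNorm_iff_not_hasGoodReductionAtPrime p).mpr hadd.1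
  -- trivial case: `p ∤ c_q`
  by_cases ht0 : padicValNat p ((W.baseChange ℚ_[q]).localTamagawaNumber ℤ_[q]) = 0
  · rw [ht0]; exact Nat.zero_le _
  have hdvd : p ∣ (W.baseChange ℚ_[q]).localTamagawaNumber ℤ_[q] :=
    dvd_of_one_le_padicValNat (Nat.one_le_iff_ne_zero.mpr ht0)
  -- the carrier place `v₀ ∣ q`, split, and the transport of the row data
  obtain ⟨v₀, hv₀, hv₀N, hqv₀⟩ := exists_split_place_of_dvd K hK τ hτ hH q hq
  obtain ⟨hminK, hminP, hcEq, hc0, hcyc⟩ := carrierRowData_of_split W K q hK τ v₀ hv₀ hqv₀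
  haveI := hminK
  haveI := hminP
  haveI := hcyc (kodairaNeron_isAddCyclic_forall W q p hp2 hdvd)
  -- `τ² = 1`
  haveI : Algebra.IsQuadraticExtension ℚ K := ⟨hK.1⟩
  have hτ2 : τ * τ = 1 := by
    have hcard : Nat.card (K ≃ₐ[ℚ] K) = 2 := by rw [IsGalois.card_aut_eq_finrank, hK.1]
    obtain ⟨y, -, hyu⟩ := (Nat.card_eq_two_iff' (1 : K ≃ₐ[ℚ] K)).mp hcard
    have h1 : τ = y := hyu τ hτ
    have h2 : τ⁻¹ = y := hyu τ⁻¹ (inv_ne_one.mpr hτ)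
    rw [mul_eq_one_iff_eq_inv]
    exact h1.trans h2.symm
  -- instances at level `p^k`
  haveI : NeZero (p ^ k) := ⟨pow_ne_zero k hp.ne_zero⟩
  haveI : Finite (geomTorsion (W.baseChange K) ((p ^ k : ℕ) : ℤ)) :=
    finite_geomTorsion_of_neZero (W.baseChange K) (p ^ k)
  have hn : ((p ^ k : ℕ) : ℤ) ≠ 0 := by exact_mod_cast pow_ne_zero k hp.ne_zero
  -- the named-print schemas at this frame
  obtain ⟨n', hcop', hGZ'⟩ := hGZg W K hK hD3 hD4 hH p hp2 hirr Dt β ι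
  -- Kolyvagin data of the core vertex
  have hc0' : c.1 ≠ 0 := c.2.1.ne_zero
  have hkc : (k : ℕ∞) ≤ Zhang2014.levelIndex W p c.1 := le_trans le_self_add hkM
  have hcK : ∀ ℓ ∈ c.1.primeFactors, Zhang2014.IsKolyvaginPrime (W.conductorNorm ℤ) W K p ℓ ∧
      k ≤ Zhang2014.kolyvaginIndex W p ℓ := fun ℓ hℓ ↦
    ⟨c.2.2 ℓ hℓ, Zhang2014.natCast_le_levelIndex_iff.mp hkc ℓ hℓ⟩
  -- the exponent over `K_{v₀}` is the exponent over `ℚ_q`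
  have hfac : (((W.baseChange K).baseChange (v₀.adicCompletion K)).localTamagawaNumber
      (v₀.adicCompletionIntegers K)).factorization p =
      padicValNat p ((W.baseChange ℚ_[q]).localTamagawaNumber ℤ_[q]) := by
    rw [hcEq, Nat.factorization_def _ hp]
  have htk' : (((W.baseChange K).baseChange (v₀.adicCompletion K)).localTamagawaNumber
      (v₀.adicCompletionIntegers K)).factorization p < k := by rw [hfac]; exact htk
  -- the intrinsic transverse family (for `h49tr` from `htr` at level `cℓ`)
  obtain ⟨𝒯, h𝒯, hT⟩ := exists_localTransverseFamily W ι ((p ^ k : ℕ) : ℤ) hc0'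
  have key := tamagawaExponent_le_mInfty_of_localFacts_of_irreducible_namedPrint_of_prop47P2 h47P2 W
    hcm K hK hD3 hD4 hH
    (hPT K) p hp2 hirr hpN Dt β ι τ hτ hτ2 hcop' hGZ' mdiv m hmdiv hm k hn c hk hcore mInf hmc hkM hik
    v₀ hv₀ hv₀N hc0 htk'
    (fun 𝒯' h𝒯' ↦ conjActPlace_mem_transverseFamily_forall W K hK ι τ hτ p k hp2 c.1 c.2.1 hcK 𝒯' h𝒯')
    (fun 𝒯' h𝒯' e hμ hadd₁ hadd₂ hgal halt hnondeg ↦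
      RingClassTransverse.localTransverseFamily_selfDual_forall W K hK hD3 hD4 ι p k hp2 c.1 c.2.1 hcK 𝒯' h𝒯'
        e hμ hadd₁ hadd₂ hgal halt hnondeg)
    (fun ℓ h1 h2 _ v hv hfix s hs ↦
      kolyvaginLocalTerm_of_poitouTate hPT W K hK τ hτ p k hp2 hk ℓ h1 h2 v hv hfix s hs)
    (fun d ℓ hℓ ↦ kolyvaginClass_mem_transverseKer W hK hD hp2 Dt β ι k c.2.1 hcK d hℓ)
    (fun ℓ h1 h2 h3 d' w hw ↦ by
      -- `h49tr` from `htr` at level `cℓ` through the reconciliation `hT`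
      have hl : ℓ.Prime := h1.1
      have hlc : ¬ ℓ ∣ c.1 := fun h ↦ h3 (Nat.mem_primeFactors.mpr ⟨hl, h, hc0'⟩)
      have hcl : Squarefree (c.1 * ℓ) :=
        (Nat.squarefree_mul ((Nat.Prime.coprime_iff_not_dvd hl).mpr hlc).symm).mpr ⟨c.2.1, hl.squarefree⟩
      have hpf : (c.1 * ℓ).primeFactors = c.1.primeFactors ∪ {ℓ} := by
        rw [Nat.primeFactors_mul hc0' hl.ne_zero, hl.primeFactors]
      have hcKℓ : ∀ l' ∈ (c.1 * ℓ).primeFactors, Zhang2014.IsKolyvaginPrime (W.conductorNorm ℤ) W K p l' ∧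
          k ≤ Zhang2014.kolyvaginIndex W p l' := by
        intro l' hl'
        rw [hpf, Finset.mem_union, Finset.mem_singleton] at hl'
        rcases hl' with h | rfl
        · exact hcK l' h
        · exact ⟨h1, h2⟩
      rw [← h𝒯 w]
      refine (hT _).mpr (fun l' hl' ↦ ?_) w hw
      exact kolyvaginClass_mem_transverseKer W hK hD hp2 Dt β ι k hcl hcKℓ d'
        (by rw [hpf]; exact Finset.mem_union_left _ hl'))
  rw [hfac] at key
  exact key

/-- **`Sig.H63IRowObjectsAddv` ⟸ {`h47P2`, `hPT`} + the NAMED Literature fact `Gross1991_heegnerPoint_sub_ratTorsion_mem_E0_imageFree`** —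
the receptacle schema FED BY NAME through `HeegnerE0ImageFree.forall_hGZ_of_Gross1991_imageFree` (witness `n' = #E(ℚ)_tors`, prime to
`p` by irreducibility). CONDITIONAL; nothing asserted. [cite: GrossLMS1991, §6, proof of Prop. 6.2 (1), p. 245]
[cite: GrossZagier1986Heegner, III (3.1) Proposition, p. 256] [cite: Jetchev2008, Thm. 5.2 (p. 821), Prop. 4.7] -/
theorem h63IRowObjectsAddv_of_poitouTate_of_Gross1991_of_prop47P2
    (h47P2 : ∀ (W : WeierstrassCurve ℚ) [W.IsElliptic] [W.IsGloballyMinimal] [NeZero (W.conductorNorm ℤ)],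
        ¬ W.HasCM →
        ∀ (K : Type) [Field K] [NumberField K], IsImaginaryQuadratic K →
        NumberField.discr K ≠ -3 → NumberField.discr K ≠ -4 →
        SatisfiesHeegnerHypothesis (W.conductorNorm ℤ) K →
        ∀ (p : ℕ) [Fact p.Prime], p ≠ 2 → W.HasIrreducibleModPGaloisRep p → (p : ℤ) ∣ W.conductorNorm ℤ →
        ∀ (Dt : ModularParametrizationData W (W.conductorNorm ℤ)) (β : ℤ) (ι : K →+* ℂ)
          (M : ℕ), 1 ≤ M →
        ∀ (m l : ℕ), Squarefree (m * l) → l.Prime → l ≠ 2 → ¬ l ∣ m →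
          (∀ l' ∈ (m * l).primeFactors, Zhang2014.IsKolyvaginPrime (W.conductorNorm ℤ) W K p l' ∧
            M ≤ Zhang2014.kolyvaginIndex W p l') →
        ∀ (d : KolyvaginHeegnerData Dt β ι m) (d' : KolyvaginHeegnerData Dt β ι (m * l)),
          (∀ l' ∈ m.primeFactors, ∀ (x : ringClassField K ι m) (x' : ringClassField K ι (m * l)),
            (x : ℂ) = x' → ((d'.σ l' x' : ringClassField K ι (m * l)) : ℂ) = (d.σ l' x : ℂ)) →
          (∀ s ∈ d.S, ∃ s' ∈ d'.S, ∀ (x : ringClassField K ι m) (x' : ringClassField K ι (m * l)),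
            (x : ℂ) = x' → ((s' x' : ringClassField K ι (m * l)) : ℂ) = (s x : ℂ)) →
          (∀ s' ∈ d'.S, ∃ s ∈ d.S, ∀ (x : ringClassField K ι m) (x' : ringClassField K ι (m * l)),
            (x : ℂ) = x' → ((s' x' : ringClassField K ι (m * l)) : ℂ) = (s x : ℂ)) →
          (∀ (x : ringClassField K ι m) (x' : ringClassField K ι (m * l)),
            (x : ℂ) = x' → d'.emb x' = d.emb x) →
        ∀ (v : HeightOneSpectrum (𝓞 K)), (l : 𝓞 K) ∈ v.asIdeal →
        ∀ (j : ℕ),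
          (((p ^ j : ℕ) : ℤ) • d'.kolyvaginClass (Fact.out : p.Prime) M ∈
              (W.baseChange K).torsionLocalKer (v.adicCompletion K) ((p ^ M : ℕ) : ℤ) ↔
            ((p ^ j : ℕ) : ℤ) • d.kolyvaginClass (Fact.out : p.Prime) M ∈
              (W.baseChange K).torsionLocalKer (v.adicCompletion K) ((p ^ M : ℕ) : ℤ)))
    (hPT : ∀ (K : Type) [Field K] [NumberField K], poitouTate_selmerStructure_duality_conj K)
    (hF1 : Gross1991_heegnerPoint_sub_ratTorsion_mem_E0_imageFree) :
    ∀ (W : WeierstrassCurve ℚ) [W.IsElliptic] [W.IsGloballyMinimal] [NeZero (W.conductorNorm ℤ)],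
    ¬ W.HasCM → ∀ (K : Type) [Field K] [NumberField K], IsImaginaryQuadratic K →
    NumberField.discr K ≠ -3 → NumberField.discr K ≠ -4 →
    SatisfiesHeegnerHypothesis (W.conductorNorm ℤ) K →
    ∀ (τ : K ≃ₐ[ℚ] K), τ ≠ 1 →
    ∀ (p : ℕ) [Fact p.Prime], p ≠ 2 → Rank1Residual.Addv W p → 0 ≤ padicValRat p W.j →
    W.HasIrreducibleModPGaloisRep p →
    ¬ p ∣ (W.baseChange ℚ_[p]).localTamagawaNumber ℤ_[p] →
    (∀ (q' : ℕ) [Fact q'.Prime], q' ∣ W.conductorNorm ℤ →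
      p ∣ (W.baseChange ℚ_[q']).localTamagawaNumber ℤ_[q'] → ¬ q' ^ 2 ∣ W.conductorNorm ℤ) →
    ∀ (Dt : ModularParametrizationData W (W.conductorNorm ℤ)) (β : ℤ) (ι : K →+* ℂ)
      [∀ k : ℕ, NumberField (ringClassField K ι k)]
      (d₁ : KolyvaginHeegnerData Dt β ι 1), ¬ IsOfFinAddOrder d₁.derivedPoint →
    ∀ (q : ℕ) [Fact q.Prime], q ∣ W.conductorNorm ℤ → ¬ q ^ 2 ∣ W.conductorNorm ℤ → q ≠ p →
    ∀ (mdiv m : {c : ℕ // Squarefree c ∧ ∀ ℓ ∈ c.primeFactors,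
        Zhang2014.IsKolyvaginPrime (W.conductorNorm ℤ) W K p ℓ} → ℕ∞),
    (∀ c (u : ℕ), (u : ℕ∞) ≤ mdiv c ↔ ∀ d : KolyvaginHeegnerData Dt β ι c.1,
      ∃ Q : (W.baseChange (ringClassField K ι c.1)).toAffine.Point,
        ((p ^ u : ℕ) : ℤ) • Q = d.derivedPoint) →
    (∀ c, m c = if mdiv c < Zhang2014.levelIndex W p c.1 then mdiv c else ⊤) →
    ∀ mInf : ℕ, (∀ c, (mInf : ℕ∞) ≤ m c) →
      (∀ m' : ℕ, ∃ c, (m' : ℕ∞) ≤ Zhang2014.levelIndex W p c.1 ∧ m c = mInf) →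
    ∀ (k : ℕ) c, 1 ≤ k → Jetchev2008.IsGlobalCoreVertex W K ι τ p k c.1 → m c = mInf →
      (k : ℕ∞) + mInf ≤ Zhang2014.levelIndex W p c.1 →
      padicValNat p ((W.baseChange ℚ_[q]).localTamagawaNumber ℤ_[q]) < k → mInf < k →
      padicValNat p ((W.baseChange ℚ_[q]).localTamagawaNumber ℤ_[q]) ≤ mInf :=
  h63IRowObjectsAddv_of_poitouTate_of_GZ31g_of_prop47P2 h47P2 hPT (HeegnerE0ImageFree.forall_hGZ_of_Gross1991_imageFree hF1)

end Summit.BirchSwinnertonDyer.BirchSwinnertonDyer.Theorems.JetchevIrreducibleReadingThm52Gross1991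

end
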